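import Summits.RiemannHypothesis.RiemannHypothesis.Theorems.WeilFormatCMixedArchRealExpansion
import HarnessLib

/-!
# Format C, design C∞ (E3, analytic side): `J_s(m)`, `J_c(m)` as MONOMIALS in `1/m` with a uniform-order remainder

Route context: Fourier–Galerkin / Schur-complement certificates of Weil positivity on a window ("format C", C∞ door;
cell memo `run/shared/lean/pub/rh-explicit/rh-explicit-weil-10/KERNEL-LEVER.md` §21; supporting stmt-RiemannHypothesis-0098;
seat rh-explicit-weil-10).  The structured tail of the C∞ coupling column (`coupling_majorant_gram_shifted`, hypotheses
`hM`/`hc`/`hV`) wants every far object written as `(−1)^m Σ_f P(f)·φ_f(m)` over the families `φ ∈ {m^{−e}, m^{−e}log m,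
S_m m^{−e}, C_m m^{−e}}` with a remainder `ρ·w(m)`.  `WeilFormatCMixedArchRealExpansion` gives the two archimedean mode
functions `J_s(m) = ∫_0^{2a} ρ(t) sin(ω_m t) dt`, `J_c(m) = ∫_0^{2a} ρ(t)(1 − cos ω_m t) dt` (`ω_m = πm/a`) as polynomials in
`1/ω_m` with an explicit multi-term remainder.  Here (no new analysis):

* `div_pow_le_scaled`, `archRemainder_le_scaled` — the UNIFORM-ORDER SCALING of a remainder all of whose terms have order
  `≥ E + 1` in `1/ω`: `rem(ω) ≤ rem(ω₀)·(ω₀/ω)^{E+1}` for `2 ≤ ω₀ ≤ ω` (so a rung evaluates ONE number `rem(ω₀)` at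
  `ω₀ = πB₃/a`);
* `abs_archSin_sub_monomials_le` — for natural modes `m ≥ m₀` (`πm₀/a ≥ 2`), `E + 1 ≤ 2ν`, `E ≤ K`, `E ≤ 2R`:
  `|J_s(m) − (π/4 + Σ_{N=1}^{K} σ_N b_N (a/(2π))^N/m^N − Σ_{r<R} (−1)^r D_{2r} (a/π)^{2r+1}/m^{2r+1})| ≤ remS(m₀)·(m₀/m)^{E+1}`;
* `abs_archCos_sub_monomials_le` — likewise
  `J_c(m) = ½log m + (½log(π/(2a)) − ½ψ(¼) − D_{−1}) + Σ_N c_N b_N (a/(2π))^N/m^N + Σ_{r<R} (−1)^r D_{2r+1}(a/π)^{2r+2}/m^{2r+2}`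
  `± remC(m₀)·(m₀/m)^{E+1}`,

`b_N = 1 − 1/(2N) − ½Σ_{k≤ν}(B_{2k}/2k)16^k C(N−1,2k−1)`, `σ = (0,1,0,−1)`, `c = (1,0,−1,0)` by `N mod 4`,
`D_s = Σ_k e^{−2al_k} l_k^s`, `D_{−1} = Σ_k e^{−2al_k}/l_k`; `remS/remC(m₀)` = the remainders of
`abs_setIntegral_sin/one_sub_cos_sub_realExpansion_le` at `m₀` verbatim.  So the `1`- and `log m`-family coefficients
contributed by `J_s`, `J_c` are read off a printed list, and the remainder constant is one box.  Elementary; standard axioms;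
no definitions; no RH claim.
-/

set_option autoImplicit false
-- `Summit.RiemannHypothesis.RiemannHypothesis.…` is the layout-mandated namespace (summit = problem name).
set_option linter.dupNamespace false

noncomputable section

open Complex Filter Set MeasureTheory
open scoped Real Topology

namespace Summit.RiemannHypothesis.RiemannHypothesis.Theorems.WeilFormatC

open Literature.NumberTheory.LFunctions Literature.Analysis.SpecialFunctions

variable {a : ℝ}

/-! ## Uniform-order remainder scaling -/

/-- For `0 < ω₀ ≤ ω` and `k ≤ n`: `(ω₀/ω)^n ≤ (ω₀/ω)^k`. -/
theorem div_pow_le_div_pow_of_le {ω₀ ω : ℝ} (hω₀ : 0 < ω₀) (hω : ω₀ ≤ ω) {k n : ℕ} (hkn : k ≤ n) :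
    (ω₀ / ω) ^ n ≤ (ω₀ / ω) ^ k :=
  pow_le_pow_of_le_one (div_nonneg hω₀.le (hω₀.le.trans hω)) (div_le_one_of_le₀ hω (hω₀.le.trans hω)) hkn

/-- Re-basing a negative power: `1/ω^n = (1/ω₀^n)·(ω₀/ω)^n` (`ω₀, ω ≠ 0`). -/
theorem one_div_pow_eq_mul_div_pow {ω₀ ω : ℝ} (hω₀ : ω₀ ≠ 0) (hω : ω ≠ 0) (n : ℕ) :
    1 / ω ^ n = 1 / ω₀ ^ n * (ω₀ / ω) ^ n := by
  have hω₀n : ω₀ ^ n ≠ 0 := pow_ne_zero _ hω₀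
  have hωn : ω ^ n ≠ 0 := pow_ne_zero _ hω
  rw [div_pow]
  field_simp

/-- **Uniform-order scaling of one remainder term**: for `0 ≤ c`, `0 < ω₀ ≤ ω`, `E + 1 ≤ n`,
`c/ω^n ≤ (c/ω₀^n)·(ω₀/ω)^{E+1}`. -/
theorem div_pow_le_scaled {c ω₀ ω : ℝ} (hc : 0 ≤ c) (hω₀ : 0 < ω₀) (hω : ω₀ ≤ ω) {E n : ℕ} (hn : E + 1 ≤ n) :
    c / ω ^ n ≤ c / ω₀ ^ n * (ω₀ / ω) ^ (E + 1) := by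
  have hω' : 0 < ω := hω₀.trans_le hω
  rw [div_eq_mul_one_div c (ω ^ n), one_div_pow_eq_mul_div_pow hω₀.ne' hω'.ne' n, ← mul_assoc,
    ← div_eq_mul_one_div]
  exact mul_le_mul_of_nonneg_left (div_pow_le_div_pow_of_le hω₀ hω hn) (div_nonneg hc (pow_nonneg hω₀.le _))

/-- Scaling of a power term: for `0 ≤ c`, `0 < ω₀ ≤ ω`, `E + 1 ≤ n`,
`c·(1/(4(ω/2)))^n ≤ c·(1/(4(ω₀/2)))^n·(ω₀/ω)^{E+1}` (the variable `t = 1/(2ω)` of the digamma expansion). -/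
theorem mul_quarterVar_pow_le_scaled {c ω₀ ω : ℝ} (hc : 0 ≤ c) (hω₀ : 0 < ω₀) (hω : ω₀ ≤ ω) {E n : ℕ}
    (hn : E + 1 ≤ n) :
    c * (1 / (4 * (ω / 2))) ^ n ≤ c * (1 / (4 * (ω₀ / 2))) ^ n * (ω₀ / ω) ^ (E + 1) := by
  have hω' : 0 < ω := hω₀.trans_le hω
  have e1 : (1 / (4 * (ω / 2))) ^ n = (1 / 2) ^ n * (1 / ω ^ n) := by
    rw [show (1 / (4 * (ω / 2)) : ℝ) = 1 / 2 * (1 / ω) by field_simp; ring, mul_pow, one_div_pow ω]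
  have e0 : (1 / (4 * (ω₀ / 2))) ^ n = (1 / 2) ^ n * (1 / ω₀ ^ n) := by
    rw [show (1 / (4 * (ω₀ / 2)) : ℝ) = 1 / 2 * (1 / ω₀) by field_simp; ring, mul_pow, one_div_pow ω₀]
  rw [e1, e0]
  have h := div_pow_le_scaled (c := c * (1 / 2) ^ n) (by positivity) hω₀ hω hn
  calc c * ((1 / 2) ^ n * (1 / ω ^ n)) = c * (1 / 2) ^ n / ω ^ n := by ring
    _ ≤ c * (1 / 2) ^ n / ω₀ ^ n * (ω₀ / ω) ^ (E + 1) := h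
    _ = c * ((1 / 2) ^ n * (1 / ω₀ ^ n)) * (ω₀ / ω) ^ (E + 1) := by ring

/-- **Uniform-order scaling of the archimedean remainder** (`2 ≤ ω₀ ≤ ω`; `E + 1 ≤ 2ν`, `E ≤ K`, `E + 1 ≤ p`; `0 ≤ D`):
the remainder of `abs_setIntegral_sin/one_sub_cos_sub_realExpansion_le` (digamma part at `t = 1/(2ω)` + node part
`D/|ω|^p`) at `ω` is at most the same expression at `ω₀` times `(ω₀/ω)^{E+1}`. -/
theorem archRemainder_le_scaled {ω₀ ω : ℝ} (hω₀ : 2 ≤ ω₀) (hω : ω₀ ≤ ω) {ν K E p : ℕ} (hE1 : E + 1 ≤ 2 * ν)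
    (hE2 : E ≤ K) (hp : E + 1 ≤ p) {D : ℝ} (hD : 0 ≤ D) :
    (4 * Real.pi ^ 2 / 3 * ((2 * ν + 1).factorial : ℝ) / (2 * Real.pi) ^ (2 * ν + 1)
            * (4 * (1 / (4 * (ω / 2)))) ^ (2 * ν)
          + (1 / (4 * (ω / 2))) ^ (K + 1) / ((K + 1) * (1 - 1 / (4 * (ω / 2))))
          + 2 * (1 / (4 * (ω / 2))) ^ (K + 1)
          + ∑ k ∈ Finset.Icc 1 ν, |(bernoulli (2 * k) : ℝ) / (2 * k)| * 2 ^ (K + 1 + 4 * k)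
              * (1 / (4 * (ω / 2))) ^ (K + 1)) / 2
        + D / |ω| ^ p
      ≤ ((4 * Real.pi ^ 2 / 3 * ((2 * ν + 1).factorial : ℝ) / (2 * Real.pi) ^ (2 * ν + 1)
              * (4 * (1 / (4 * (ω₀ / 2)))) ^ (2 * ν)
            + (1 / (4 * (ω₀ / 2))) ^ (K + 1) / ((K + 1) * (1 - 1 / (4 * (ω₀ / 2))))
            + 2 * (1 / (4 * (ω₀ / 2))) ^ (K + 1)
            + ∑ k ∈ Finset.Icc 1 ν, |(bernoulli (2 * k) : ℝ) / (2 * k)| * 2 ^ (K + 1 + 4 * k)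
                * (1 / (4 * (ω₀ / 2))) ^ (K + 1)) / 2
          + D / |ω₀| ^ p) * (ω₀ / ω) ^ (E + 1) := by
  have hω₀' : 0 < ω₀ := by linarith
  have hω' : 0 < ω := hω₀'.trans_le hω
  set y : ℝ := (ω₀ / ω) ^ (E + 1) with hy
  have hy0 : 0 ≤ y := pow_nonneg (div_nonneg hω₀'.le hω'.le) _
  have hK1 : E + 1 ≤ K + 1 := by omega
  -- term 1 (Bernoulli tail): order 2ν
  have hA : 4 * Real.pi ^ 2 / 3 * ((2 * ν + 1).factorial : ℝ) / (2 * Real.pi) ^ (2 * ν + 1)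
        * (4 * (1 / (4 * (ω / 2)))) ^ (2 * ν)
      ≤ 4 * Real.pi ^ 2 / 3 * ((2 * ν + 1).factorial : ℝ) / (2 * Real.pi) ^ (2 * ν + 1)
        * (4 * (1 / (4 * (ω₀ / 2)))) ^ (2 * ν) * y := by
    rw [show (4 * (1 / (4 * (ω / 2)))) ^ (2 * ν) = 4 ^ (2 * ν) * (1 / (4 * (ω / 2))) ^ (2 * ν) from
        mul_pow _ _ _, show (4 * (1 / (4 * (ω₀ / 2)))) ^ (2 * ν) = 4 ^ (2 * ν) * (1 / (4 * (ω₀ / 2))) ^ (2 * ν)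
        from mul_pow _ _ _, ← mul_assoc, ← mul_assoc]
    exact mul_quarterVar_pow_le_scaled (by positivity) hω₀' hω hE1
  -- term 2 (log tail): order K+1, and `1/(1 − t)` decreases in `ω`
  have ht₀ : 1 / (4 * (ω₀ / 2)) ≤ 1 / 4 := by
    rw [div_le_div_iff₀ (by positivity) (by norm_num)]; linarith
  have htt : 1 / (4 * (ω / 2)) ≤ 1 / (4 * (ω₀ / 2)) :=
    one_div_le_one_div_of_le (by positivity) (by linarith)
  have hB : (1 / (4 * (ω / 2))) ^ (K + 1) / ((K + 1) * (1 - 1 / (4 * (ω / 2))))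
      ≤ (1 / (4 * (ω₀ / 2))) ^ (K + 1) / ((K + 1) * (1 - 1 / (4 * (ω₀ / 2)))) * y := by
    have hden₀ : 0 < (K + 1 : ℝ) * (1 - 1 / (4 * (ω₀ / 2))) := by
      apply mul_pos (by positivity); linarith
    have hden : (K + 1 : ℝ) * (1 - 1 / (4 * (ω₀ / 2))) ≤ (K + 1) * (1 - 1 / (4 * (ω / 2))) := by
      apply mul_le_mul_of_nonneg_left _ (by positivity); linarith
    calc (1 / (4 * (ω / 2))) ^ (K + 1) / ((K + 1) * (1 - 1 / (4 * (ω / 2))))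
        ≤ (1 / (4 * (ω / 2))) ^ (K + 1) / ((K + 1) * (1 - 1 / (4 * (ω₀ / 2)))) :=
          div_le_div_of_nonneg_left (by positivity) hden₀ hden
      _ = 1 / ((K + 1) * (1 - 1 / (4 * (ω₀ / 2)))) * (1 / (4 * (ω / 2))) ^ (K + 1) := by ring
      _ ≤ 1 / ((K + 1) * (1 - 1 / (4 * (ω₀ / 2)))) * (1 / (4 * (ω₀ / 2))) ^ (K + 1) * y :=
          mul_quarterVar_pow_le_scaled (by positivity) hω₀' hω hK1
      _ = (1 / (4 * (ω₀ / 2))) ^ (K + 1) / ((K + 1) * (1 - 1 / (4 * (ω₀ / 2)))) * y := by ring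
  -- term 3: order K+1
  have hC : 2 * (1 / (4 * (ω / 2))) ^ (K + 1) ≤ 2 * (1 / (4 * (ω₀ / 2))) ^ (K + 1) * y :=
    mul_quarterVar_pow_le_scaled (by norm_num) hω₀' hω hK1
  -- term 4: order K+1
  have hS : ∑ k ∈ Finset.Icc 1 ν, |(bernoulli (2 * k) : ℝ) / (2 * k)| * 2 ^ (K + 1 + 4 * k)
        * (1 / (4 * (ω / 2))) ^ (K + 1)
      ≤ (∑ k ∈ Finset.Icc 1 ν, |(bernoulli (2 * k) : ℝ) / (2 * k)| * 2 ^ (K + 1 + 4 * k)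
        * (1 / (4 * (ω₀ / 2))) ^ (K + 1)) * y := by
    rw [Finset.sum_mul]
    exact Finset.sum_le_sum fun k _ ↦ mul_quarterVar_pow_le_scaled (by positivity) hω₀' hω hK1
  -- term 5 (node part): order p
  have hT : D / |ω| ^ p ≤ D / |ω₀| ^ p * y := by
    rw [abs_of_pos hω', abs_of_pos hω₀']
    exact div_pow_le_scaled hD hω₀' hω hp
  calc _ ≤ (4 * Real.pi ^ 2 / 3 * ((2 * ν + 1).factorial : ℝ) / (2 * Real.pi) ^ (2 * ν + 1)
              * (4 * (1 / (4 * (ω₀ / 2)))) ^ (2 * ν) * y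
            + (1 / (4 * (ω₀ / 2))) ^ (K + 1) / ((K + 1) * (1 - 1 / (4 * (ω₀ / 2)))) * y
            + 2 * (1 / (4 * (ω₀ / 2))) ^ (K + 1) * y
            + (∑ k ∈ Finset.Icc 1 ν, |(bernoulli (2 * k) : ℝ) / (2 * k)| * 2 ^ (K + 1 + 4 * k)
                * (1 / (4 * (ω₀ / 2))) ^ (K + 1)) * y) / 2
          + D / |ω₀| ^ p * y := by gcongr
    _ = _ := by ring

/-- The archimedean remainder is nonnegative (`2 ≤ ω₀`, `0 ≤ D`). -/
theorem archRemainder_nonneg {ω₀ : ℝ} (hω₀ : 2 ≤ ω₀) (ν K p : ℕ) {D : ℝ} (hD : 0 ≤ D) :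
    0 ≤ (4 * Real.pi ^ 2 / 3 * ((2 * ν + 1).factorial : ℝ) / (2 * Real.pi) ^ (2 * ν + 1)
            * (4 * (1 / (4 * (ω₀ / 2)))) ^ (2 * ν)
          + (1 / (4 * (ω₀ / 2))) ^ (K + 1) / ((K + 1) * (1 - 1 / (4 * (ω₀ / 2))))
          + 2 * (1 / (4 * (ω₀ / 2))) ^ (K + 1)
          + ∑ k ∈ Finset.Icc 1 ν, |(bernoulli (2 * k) : ℝ) / (2 * k)| * 2 ^ (K + 1 + 4 * k)
              * (1 / (4 * (ω₀ / 2))) ^ (K + 1)) / 2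
        + D / |ω₀| ^ p := by
  have hω₀' : 0 < ω₀ := by linarith
  have ht : 1 - 1 / (4 * (ω₀ / 2)) > 0 := by
    have : 1 / (4 * (ω₀ / 2)) ≤ 1 / 4 := by
      rw [div_le_div_iff₀ (by positivity) (by norm_num)]; linarith
    linarith
  positivity

/-! ## `J_s(m)` and `J_c(m)` as monomial sums in `1/m` -/

/-- Re-basing one power of the frequency: `1/(2^N ω_m^N) = (a/(2π))^N/m^N` (`a ≠ 0`, `m ≠ 0`). -/
theorem one_div_two_pow_mul_freq_pow (ha : a ≠ 0) {m : ℝ} (hm : m ≠ 0) (N : ℕ) :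
    1 / (2 ^ N * (π * m / a) ^ N) = (a / (2 * π)) ^ N / m ^ N := by
  have hπ : (π : ℝ) ≠ 0 := Real.pi_ne_zero
  rw [div_pow, div_pow, mul_pow, mul_pow]
  field_simp

/-- Re-basing: `1/ω_m^n = (a/π)^n/m^n` (`a ≠ 0`, `m ≠ 0`). -/
theorem one_div_freq_pow (ha : a ≠ 0) {m : ℝ} (hm : m ≠ 0) (n : ℕ) :
    1 / (π * m / a) ^ n = (a / π) ^ n / m ^ n := by
  have hπ : (π : ℝ) ≠ 0 := Real.pi_ne_zero
  rw [div_pow, div_pow, mul_pow]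
  field_simp

/-- `ω₀/ω = m₀/m` for the frequencies `ω = πm/a` (`a ≠ 0`, `m ≠ 0`). -/
theorem freq_div_freq (ha : a ≠ 0) {m₀ m : ℝ} (hm : m ≠ 0) :
    (π * m₀ / a) / (π * m / a) = m₀ / m := by
  field_simp

/-- **`J_s(m)` as a monomial sum in `1/m`** (`a > 0`; natural modes `m ≥ m₀` with `πm₀/a ≥ 2`; `ν ≥ 1`, `2ν ≤ K`;
uniform order `E` with `E + 1 ≤ 2ν`, `E ≤ K`, `E ≤ 2R`):
`|J_s(m) − (π/4 + Σ_{N=1}^{K} σ_N b_N (a/(2π))^N/m^N − Σ_{r<R} (−1)^r D_{2r}(a/π)^{2r+1}/m^{2r+1})| ≤ remS(m₀)·(m₀/m)^{E+1}`,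
`remS(m₀)` being the remainder of `abs_setIntegral_sin_sub_realExpansion_le` at the mode `m₀`. -/
theorem abs_archSin_sub_monomials_le (ha : 0 < a) {m₀ m : ℕ} (hm₀ : 2 ≤ π * m₀ / a) (hmm : m₀ ≤ m)
    {ν : ℕ} (hν : ν ≠ 0) {K : ℕ} (hK : 2 * ν ≤ K) (R : ℕ) {E : ℕ} (hE1 : E + 1 ≤ 2 * ν) (hE2 : E ≤ K)
    (hE3 : E ≤ 2 * R) :
    |(∫ t in Ioc 0 (2 * a), weilArchDensity t * Real.sin (π * m / a * t))
        - (π / 4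
            + ∑ N ∈ Finset.Icc 1 K, (if N % 4 = 1 then (1 : ℝ) else if N % 4 = 3 then -1 else 0)
                * (1 - 1 / (2 * (N : ℝ))
                    - (∑ k ∈ Finset.Icc 1 ν, (bernoulli (2 * k) : ℝ) / (2 * k) * 16 ^ k
                        * (((N - 1).choose (2 * k - 1) : ℕ) : ℝ)) / 2)
                * (a / (2 * π)) ^ N / (m : ℝ) ^ N
            - ∑ r ∈ Finset.range R, (-1 : ℝ) ^ r *
                (∑' k : ℕ, Real.exp (-(2 * a * digammaNode k)) * digammaNode k ^ (2 * r))
                * (a / π) ^ (2 * r + 1) / (m : ℝ) ^ (2 * r + 1))|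
      ≤ ((4 * Real.pi ^ 2 / 3 * ((2 * ν + 1).factorial : ℝ) / (2 * Real.pi) ^ (2 * ν + 1)
              * (4 * (1 / (4 * (π * m₀ / a / 2)))) ^ (2 * ν)
            + (1 / (4 * (π * m₀ / a / 2))) ^ (K + 1) / ((K + 1) * (1 - 1 / (4 * (π * m₀ / a / 2))))
            + 2 * (1 / (4 * (π * m₀ / a / 2))) ^ (K + 1)
            + ∑ k ∈ Finset.Icc 1 ν, |(bernoulli (2 * k) : ℝ) / (2 * k)| * 2 ^ (K + 1 + 4 * k)
                * (1 / (4 * (π * m₀ / a / 2))) ^ (K + 1)) / 2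
          + (∑' k : ℕ, Real.exp (-(2 * a * digammaNode k)) * digammaNode k ^ (2 * R))
              / |π * m₀ / a| ^ (2 * R + 1))
        * ((m₀ : ℝ) / m) ^ (E + 1) := by
  have hπa : 0 < π / a := div_pos Real.pi_pos ha
  have hm₀pos : (0 : ℝ) < m₀ := by
    rcases Nat.eq_zero_or_pos m₀ with h0 | h0
    · exfalso; subst h0; norm_num at hm₀
    · exact_mod_cast h0
  have hmm' : (m₀ : ℝ) ≤ m := by exact_mod_cast hmm
  have hmpos : (0 : ℝ) < m := hm₀pos.trans_le hmm'
  have hω : π * (m₀ : ℝ) / a ≤ π * m / a := by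
    rw [mul_div_right_comm, mul_div_right_comm]; exact mul_le_mul_of_nonneg_left hmm' hπa.le
  have hm : 2 ≤ π * ((m : ℤ) : ℝ) / a := by rw [Int.cast_natCast]; exact hm₀.trans hω
  have h := abs_setIntegral_sin_sub_realExpansion_le ha hm hν hK R
  simp only [Int.cast_natCast] at h
  -- the approximants agree
  have e1 : ∀ N ∈ Finset.Icc 1 K, (if N % 4 = 1 then (1 : ℝ) else if N % 4 = 3 then -1 else 0)
        * (1 - 1 / (2 * (N : ℝ))
            - (∑ k ∈ Finset.Icc 1 ν, (bernoulli (2 * k) : ℝ) / (2 * k) * 16 ^ k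
                * (((N - 1).choose (2 * k - 1) : ℕ) : ℝ)) / 2)
        / (2 ^ N * (π * m / a) ^ N)
      = (if N % 4 = 1 then (1 : ℝ) else if N % 4 = 3 then -1 else 0)
        * (1 - 1 / (2 * (N : ℝ))
            - (∑ k ∈ Finset.Icc 1 ν, (bernoulli (2 * k) : ℝ) / (2 * k) * 16 ^ k
                * (((N - 1).choose (2 * k - 1) : ℕ) : ℝ)) / 2)
        * (a / (2 * π)) ^ N / (m : ℝ) ^ N := by
    intro N _
    rw [div_eq_mul_one_div _ (2 ^ N * (π * m / a) ^ N), one_div_two_pow_mul_freq_pow ha.ne' hmpos.ne' N,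
      mul_div_assoc]
  have e2 : ∀ r ∈ Finset.range R, (-1 : ℝ) ^ r *
        (∑' k : ℕ, Real.exp (-(2 * a * digammaNode k)) * digammaNode k ^ (2 * r)) / (π * m / a) ^ (2 * r + 1)
      = (-1 : ℝ) ^ r * (∑' k : ℕ, Real.exp (-(2 * a * digammaNode k)) * digammaNode k ^ (2 * r))
        * (a / π) ^ (2 * r + 1) / (m : ℝ) ^ (2 * r + 1) := by
    intro r _
    rw [div_eq_mul_one_div _ ((π * m / a) ^ (2 * r + 1)), one_div_freq_pow ha.ne' hmpos.ne', mul_div_assoc]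
  rw [Finset.sum_congr rfl e1, Finset.sum_congr rfl e2] at h
  refine h.trans ?_
  have hsc := archRemainder_le_scaled (ν := ν) (K := K) (E := E) (p := 2 * R + 1)
    (D := ∑' k : ℕ, Real.exp (-(2 * a * digammaNode k)) * digammaNode k ^ (2 * R)) hm₀ hω hE1 hE2 (by omega)
    (tsum_nonneg fun k ↦ mul_nonneg (Real.exp_nonneg _) (pow_nonneg (digammaNode_pos k).le _))
  rw [freq_div_freq ha.ne' hmpos.ne'] at hsc
  exact hsc

/-- **`J_c(m)` as a monomial sum in `1/m`** (`a > 0`; natural modes `m ≥ m₀` with `πm₀/a ≥ 2`; `ν ≥ 1`, `2ν ≤ K`;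
uniform order `E` with `E + 1 ≤ 2ν`, `E ≤ K`, `E ≤ 2R + 1`):
`|J_c(m) − (½log m + (½log(π/(2a)) − ½ψ(¼) − D_{−1}) + Σ_{N=1}^{K} c_N b_N (a/(2π))^N/m^N`
`  + Σ_{r<R} (−1)^r D_{2r+1}(a/π)^{2r+2}/m^{2r+2})| ≤ remC(m₀)·(m₀/m)^{E+1}`,
`remC(m₀)` being the remainder of `abs_setIntegral_one_sub_cos_sub_realExpansion_le` at the mode `m₀`.  The `log m`
family of the C∞ tail enters ONLY through the leading `½log m` here. -/
theorem abs_archCos_sub_monomials_le (ha : 0 < a) {m₀ m : ℕ} (hm₀ : 2 ≤ π * m₀ / a) (hmm : m₀ ≤ m)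
    {ν : ℕ} (hν : ν ≠ 0) {K : ℕ} (hK : 2 * ν ≤ K) (R : ℕ) {E : ℕ} (hE1 : E + 1 ≤ 2 * ν) (hE2 : E ≤ K)
    (hE3 : E ≤ 2 * R + 1) :
    |(∫ t in Ioc 0 (2 * a), weilArchDensity t * (1 - Real.cos (π * m / a * t)))
        - (Real.log m / 2
            + (Real.log (π / (2 * a)) / 2 - reDigammaQuarter 0 / 2
                - ∑' k : ℕ, Real.exp (-(2 * a * digammaNode k)) / digammaNode k)
            + ∑ N ∈ Finset.Icc 1 K, (if N % 4 = 0 then (1 : ℝ) else if N % 4 = 2 then -1 else 0)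
                * (1 - 1 / (2 * (N : ℝ))
                    - (∑ k ∈ Finset.Icc 1 ν, (bernoulli (2 * k) : ℝ) / (2 * k) * 16 ^ k
                        * (((N - 1).choose (2 * k - 1) : ℕ) : ℝ)) / 2)
                * (a / (2 * π)) ^ N / (m : ℝ) ^ N
            + ∑ r ∈ Finset.range R, (-1 : ℝ) ^ r *
                (∑' k : ℕ, Real.exp (-(2 * a * digammaNode k)) * digammaNode k ^ (2 * r + 1))
                * (a / π) ^ (2 * r + 2) / (m : ℝ) ^ (2 * r + 2))|
      ≤ ((4 * Real.pi ^ 2 / 3 * ((2 * ν + 1).factorial : ℝ) / (2 * Real.pi) ^ (2 * ν + 1)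
              * (4 * (1 / (4 * (π * m₀ / a / 2)))) ^ (2 * ν)
            + (1 / (4 * (π * m₀ / a / 2))) ^ (K + 1) / ((K + 1) * (1 - 1 / (4 * (π * m₀ / a / 2))))
            + 2 * (1 / (4 * (π * m₀ / a / 2))) ^ (K + 1)
            + ∑ k ∈ Finset.Icc 1 ν, |(bernoulli (2 * k) : ℝ) / (2 * k)| * 2 ^ (K + 1 + 4 * k)
                * (1 / (4 * (π * m₀ / a / 2))) ^ (K + 1)) / 2
          + (∑' k : ℕ, Real.exp (-(2 * a * digammaNode k)) * digammaNode k ^ (2 * R + 1))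
              / |π * m₀ / a| ^ (2 * R + 2))
        * ((m₀ : ℝ) / m) ^ (E + 1) := by
  have hπa : 0 < π / a := div_pos Real.pi_pos ha
  have hm₀pos : (0 : ℝ) < m₀ := by
    rcases Nat.eq_zero_or_pos m₀ with h0 | h0
    · exfalso; subst h0; norm_num at hm₀
    · exact_mod_cast h0
  have hmm' : (m₀ : ℝ) ≤ m := by exact_mod_cast hmm
  have hmpos : (0 : ℝ) < m := hm₀pos.trans_le hmm'
  have hω : π * (m₀ : ℝ) / a ≤ π * m / a := by
    rw [mul_div_right_comm, mul_div_right_comm]; exact mul_le_mul_of_nonneg_left hmm' hπa.le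
  have hm : 2 ≤ π * ((m : ℤ) : ℝ) / a := by rw [Int.cast_natCast]; exact hm₀.trans hω
  have h := abs_setIntegral_one_sub_cos_sub_realExpansion_le ha hm hν hK R
  simp only [Int.cast_natCast] at h
  -- the approximants agree
  have elog : Real.log (π * m / a / 2) / 2 = Real.log m / 2 + Real.log (π / (2 * a)) / 2 := by
    rw [show π * (m : ℝ) / a / 2 = m * (π / (2 * a)) by ring,
      Real.log_mul hmpos.ne' (by positivity)]
    ring
  have e1 : ∀ N ∈ Finset.Icc 1 K, (if N % 4 = 0 then (1 : ℝ) else if N % 4 = 2 then -1 else 0)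
        * (1 - 1 / (2 * (N : ℝ))
            - (∑ k ∈ Finset.Icc 1 ν, (bernoulli (2 * k) : ℝ) / (2 * k) * 16 ^ k
                * (((N - 1).choose (2 * k - 1) : ℕ) : ℝ)) / 2)
        / (2 ^ N * (π * m / a) ^ N)
      = (if N % 4 = 0 then (1 : ℝ) else if N % 4 = 2 then -1 else 0)
        * (1 - 1 / (2 * (N : ℝ))
            - (∑ k ∈ Finset.Icc 1 ν, (bernoulli (2 * k) : ℝ) / (2 * k) * 16 ^ k
                * (((N - 1).choose (2 * k - 1) : ℕ) : ℝ)) / 2)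
        * (a / (2 * π)) ^ N / (m : ℝ) ^ N := by
    intro N _
    rw [div_eq_mul_one_div _ (2 ^ N * (π * m / a) ^ N), one_div_two_pow_mul_freq_pow ha.ne' hmpos.ne' N,
      mul_div_assoc]
  have e2 : ∀ r ∈ Finset.range R, (-1 : ℝ) ^ r *
        (∑' k : ℕ, Real.exp (-(2 * a * digammaNode k)) * digammaNode k ^ (2 * r + 1))
          / (π * m / a) ^ (2 * r + 2)
      = (-1 : ℝ) ^ r * (∑' k : ℕ, Real.exp (-(2 * a * digammaNode k)) * digammaNode k ^ (2 * r + 1))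
        * (a / π) ^ (2 * r + 2) / (m : ℝ) ^ (2 * r + 2) := by
    intro r _
    rw [div_eq_mul_one_div _ ((π * m / a) ^ (2 * r + 2)), one_div_freq_pow ha.ne' hmpos.ne', mul_div_assoc]
  rw [elog, Finset.sum_congr rfl e1, Finset.sum_congr rfl e2] at h
  have eapp : Real.log m / 2 + Real.log (π / (2 * a)) / 2
        + ∑ N ∈ Finset.Icc 1 K, (if N % 4 = 0 then (1 : ℝ) else if N % 4 = 2 then -1 else 0)
            * (1 - 1 / (2 * (N : ℝ))
                - (∑ k ∈ Finset.Icc 1 ν, (bernoulli (2 * k) : ℝ) / (2 * k) * 16 ^ k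
                    * (((N - 1).choose (2 * k - 1) : ℕ) : ℝ)) / 2)
            * (a / (2 * π)) ^ N / (m : ℝ) ^ N
        - reDigammaQuarter 0 / 2
        - (∑' k : ℕ, Real.exp (-(2 * a * digammaNode k)) / digammaNode k)
        + ∑ r ∈ Finset.range R, (-1 : ℝ) ^ r *
            (∑' k : ℕ, Real.exp (-(2 * a * digammaNode k)) * digammaNode k ^ (2 * r + 1))
            * (a / π) ^ (2 * r + 2) / (m : ℝ) ^ (2 * r + 2)
      = Real.log m / 2
        + (Real.log (π / (2 * a)) / 2 - reDigammaQuarter 0 / 2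
            - ∑' k : ℕ, Real.exp (-(2 * a * digammaNode k)) / digammaNode k)
        + ∑ N ∈ Finset.Icc 1 K, (if N % 4 = 0 then (1 : ℝ) else if N % 4 = 2 then -1 else 0)
            * (1 - 1 / (2 * (N : ℝ))
                - (∑ k ∈ Finset.Icc 1 ν, (bernoulli (2 * k) : ℝ) / (2 * k) * 16 ^ k
                    * (((N - 1).choose (2 * k - 1) : ℕ) : ℝ)) / 2)
            * (a / (2 * π)) ^ N / (m : ℝ) ^ N
        + ∑ r ∈ Finset.range R, (-1 : ℝ) ^ r *
            (∑' k : ℕ, Real.exp (-(2 * a * digammaNode k)) * digammaNode k ^ (2 * r + 1))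
            * (a / π) ^ (2 * r + 2) / (m : ℝ) ^ (2 * r + 2) := by ring
  rw [eapp] at h
  refine h.trans ?_
  have hsc := archRemainder_le_scaled (ν := ν) (K := K) (E := E) (p := 2 * R + 2)
    (D := ∑' k : ℕ, Real.exp (-(2 * a * digammaNode k)) * digammaNode k ^ (2 * R + 1)) hm₀ hω hE1 hE2 (by omega)
    (tsum_nonneg fun k ↦ mul_nonneg (Real.exp_nonneg _) (pow_nonneg (digammaNode_pos k).le _))
  rw [freq_div_freq ha.ne' hmpos.ne'] at hsc
  exact hsc

end Summit.RiemannHypothesis.RiemannHypothesis.Theorems.WeilFormatC
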